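import Summits.QuantumFields.BalabanUV.T4Continuum.Support.ShellMeasureRayWiring
import Summits.QuantumFields.BalabanUV.T4Continuum.Support.ShellMeasureLandauFixedPoint

/-!
# `T4Continuum.ShellMeasureRayTermsAlong` — SM-L4's per-term ray pairs THROUGH the kernel Landau ray: END-II's
# `hE` from per-term FUNCTIONAL pairs of (1.18)/(2.31) TYPE composed with the holomorphic minimiser curve of row S22
# (cell `pub-balaban`, sub-cell `t4`, spine estimate NE7c (node U5b); NE7c formalisation swarm, crew seat
# `b2b-balaban-t4-ne7c-formalise-leaf-02` gen 2 — a JUNCTION of crew row S16 (`ShellMeasureRayWiring`, leaf-05,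
# p208639) with OFFERED row S22 file 2 (`ShellMeasureLandauFixedPoint`, p210318); imports exactly these two; 0 `def`,
# 0 sorry)

HONEST FRAMING.  Finite four-torus programme, rung (B)+1 only — NOT infinite volume, NOT a mass gap, NOT the Clay
problem, NOT summit progress; (B), `BetaPertHyp`, (B^μ) not consumed.  NE7c (`T4IndicatorShell.ShellWeightBound`) is
NOT PRINTED and NOT PROVED; «NE7c ⇐ the named binders».  Row S16 re-sourced END-II's SM-L4 binder `hE` (the forward
ray bound of the non-Wilson effective-action part `𝓔` along the block-chart contraction) to PER-TERM
analyticity–oscillation pairs of ONE COMPLEX VARIABLE: per window point `x`, holomorphic `g x i : ℂ → ℂ` on the disc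
`‖w‖ < R` with `‖g x i w − g x i 0‖ ≤ H x i`, `Σ H ≤ H̄` (`rayBound_of_analytic_terms`); the crew's S6 locator (leaf-05,
GAPS G-ne7cL05-1) recorded that print DISPLAYS such pairs PER TERM as FUNCTIONALS OF THE CONFIGURATION —
[Balaban1987RG1] (1.18) «|𝐄^{(j)}(X, 𝓗)| ≤ E₀e^{−κd_j(X)}» on the complex domains (1.11)–(1.16), [Balaban1988Convergent]
(2.31), (2.42) — while the «composite analyticity through the localized minimiser along the one-parameter complexified
perturbation» (B12 Lemma 4 (3.53) TYPE) is NOT PRINTED for the block-chart contraction.  THIS FILE makes that composite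
step KERNEL: row S22 file 2 CONSTRUCTS the minimiser's Landau-gauge configuration along the contraction ray,
`σ ↦ 𝓗_σ = Y_σ − H D_σ` (Prop. 6 scheme + Sect. C scheme, `B13Contraction113` by name), holomorphic on the disc with
`‖𝓗_σ‖ < ε + 4C₂B₀ε²`; composing DISPLAYED-TYPE per-term FUNCTIONALS `𝓔_i : 𝒴 → ℂ` — Fréchet-analytic on a ball
`‖Z‖ < r_E` of the (115)-normed configuration space with sup bounds `‖𝓔_i Z‖ ≤ e_i` ((1.18)/(2.31) TYPE: print states
analyticity and the bound `E₀e^{−κd_j(X)}` on the complex domains (1.11)–(1.16) ∕ (2.34)–(2.39), which are NOT norm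
balls — the MODELLING here is «a ball of the (115)-norm about the flat configuration contained in that domain», a
located inclusion of the same kind as `B11Prop6Scheme`'s D-B11-20; the terms' K-independent summability `Σ 2e_i ≤ H̄`
is located, (1.19)-kind, S6 verdict item (ii)) — with ANY such holomorphic curve gives EXACTLY S16's
per-term data (`termCurve_of_functional`: holomorphic on the disc, oscillation `≤ 2e_i`), hence END-II's `hE` with
`B_𝓔 = 3H̄/(R − 1)` by `rayBound_of_analytic_terms` BY NAME (`hE_of_functionals_along`), given the DICTIONARY
«`𝓔 V (c • x) = Re Σ_i 𝓔_i(𝓗_x(c))` on `[0,1]`» (located, as every dictionary of the road) and the located coupling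
`ε + 4C₂B₀ε² ≤ r_E` (the ray's Landau configurations lie in the terms' analyticity domain — (1.11)–(1.16)-kind).
§3 shows that row S22's Landau ray inhabits the curve hypotheses (`landauRay_curve`).  AFTER THIS FILE SM-L4 on this
road reads: `hE` ⇐ per-term functional pairs ((1.18)/(2.31)/(2.42) TYPE, Fréchet on a ball) ∧ their located sum `H̄` ∧
the coupling `ε + 4C₂B₀ε² ≤ r_E` ∧ the 𝓔-dictionary ∧ [the S22 ray's own binders] — the composite analyticity through
the minimiser is no longer a binder.  Nothing of the audited series is discharged; renders as cited in rows S6/S16/S22.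
0 sorry, 0 `def`.  HONEST DEPENDENCY (cell): continuum YM on T⁴ ⇐ BetaPertH ∧ nine spine estimates (0/9 proved);
BetaPertH ⇐ (D1) ∧ (D4) ∧ CAP+tail; G-an2-4 gates asym, D1 and NE2/3/4.
-/

noncomputable section

open Set Metric

namespace Summit.QuantumFields.BalabanUV.T4Continuum.ShellMeasureRayTermsAlong

open ShellMeasureRayWiring (rayBound_of_analytic_terms rayConst_nonneg)

variable {𝒴 : Type*} [NormedAddCommGroup 𝒴] [NormedSpace ℂ 𝒴]

/-! ## §1 One term: a Fréchet-analytic functional along a holomorphic curve -/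

/-- **A PER-TERM FUNCTIONAL ALONG A HOLOMORPHIC CURVE.**  `𝓔_i` Fréchet-analytic on the ball `‖Z‖ < r_E` with
`‖𝓔_i Z‖ ≤ e` there ((1.18)/(2.31) TYPE), `𝓗` holomorphic on the disc `‖w‖ < R` (`0 < R`) with values in that ball
⟹ `w ↦ 𝓔_i(𝓗 w)` is holomorphic on the disc with oscillation `‖𝓔_i(𝓗 w) − 𝓔_i(𝓗 0)‖ ≤ 2e` — the per-term pair of
`ShellMeasureRayWiring.rayBound_of_analytic_terms`. [folklore] -/
theorem termCurve_of_functional {Ef : 𝒴 → ℂ} {rE e : ℝ} (hEd : DifferentiableOn ℂ Ef (ball 0 rE))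
    (hEb : ∀ Z ∈ ball (0 : 𝒴) rE, ‖Ef Z‖ ≤ e) {𝓗 : ℂ → 𝒴} {R : ℝ} (hR : 0 < R)
    (h𝓗d : DifferentiableOn ℂ 𝓗 (ball 0 R)) (h𝓗b : MapsTo 𝓗 (ball (0 : ℂ) R) (ball (0 : 𝒴) rE)) :
    DifferentiableOn ℂ (fun w => Ef (𝓗 w)) (ball 0 R) ∧
      ∀ w ∈ ball (0 : ℂ) R, ‖Ef (𝓗 w) - Ef (𝓗 0)‖ ≤ 2 * e := by
  refine ⟨hEd.comp h𝓗d h𝓗b, fun w hw => ?_⟩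
  calc ‖Ef (𝓗 w) - Ef (𝓗 0)‖ ≤ ‖Ef (𝓗 w)‖ + ‖Ef (𝓗 0)‖ := norm_sub_le _ _
    _ ≤ e + e := add_le_add (hEb _ (h𝓗b hw)) (hEb _ (h𝓗b (mem_ball_self hR)))
    _ = 2 * e := by ring

/-! ## §2 END-II's `hE` from per-term functionals through a family of holomorphic curves -/

section EndTwo

variable {E : Type*} [AddCommGroup E] [Module ℝ E]

/-- **SM-L4 FROM PER-TERM FUNCTIONAL PAIRS THROUGH HOLOMORPHIC CURVES.**  Data: a finite set `I` of term functionals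
`𝓔_i : 𝒴 → ℂ`, each Fréchet-analytic on `ball 0 r_E` with sup bound `e_i`, `Σ_{i∈I} 2e_i ≤ H̄`; per window point
`x ∈ W` a holomorphic curve `𝓗 x` on the disc `‖w‖ < R` (`1 < R`) with values in `ball 0 r_E` (for row S22's Landau
ray: §3 + the located coupling `ε + 4C₂B₀ε² ≤ r_E`); the DICTIONARY `Re Σ_i 𝓔_i(𝓗 x c) = 𝓔 (c • x)` on `[0,1]`.
CONCLUSION — LITERALLY END-II's binder `hE` (via `ShellMeasureRayWiring.rayBound_of_analytic_terms` BY NAME):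
`∀ x ∈ W, ∀ c, 1/2 ≤ c → c ≤ 1 → 𝓔 (c • x) ≤ 𝓔 x + (1 − c) * (3 H̄ / (R − 1))`. [folklore] -/
theorem hE_of_functionals_along {W : Set E} {ι : Type*} (I : Finset ι) {Ef : ι → 𝒴 → ℂ} {rE : ℝ} {e : ι → ℝ}
    {Hbar : ℝ} (hEd : ∀ i ∈ I, DifferentiableOn ℂ (Ef i) (ball 0 rE))
    (hEb : ∀ i ∈ I, ∀ Z ∈ ball (0 : 𝒴) rE, ‖Ef i Z‖ ≤ e i) (hsum : ∑ i ∈ I, 2 * e i ≤ Hbar)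
    {𝓗 : E → ℂ → 𝒴} {R : ℝ} (hR : 1 < R) (h𝓗d : ∀ x ∈ W, DifferentiableOn ℂ (𝓗 x) (ball 0 R))
    (h𝓗b : ∀ x ∈ W, MapsTo (𝓗 x) (ball (0 : ℂ) R) (ball (0 : 𝒴) rE)) {𝓔 : E → ℝ}
    (hreal : ∀ x ∈ W, ∀ c : ℝ, 0 ≤ c → c ≤ 1 → (∑ i ∈ I, Ef i (𝓗 x (c : ℂ))).re = 𝓔 (c • x)) :
    ∀ x ∈ W, ∀ c : ℝ, 1 / 2 ≤ c → c ≤ 1 → 𝓔 (c • x) ≤ 𝓔 x + (1 - c) * (3 * Hbar / (R - 1)) := by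
  have hR0 : 0 < R := by linarith
  refine rayBound_of_analytic_terms (fun _ => I) (g := fun x i w => Ef i (𝓗 x w)) (H := fun _ i => 2 * e i) hR
    (fun x hx i hi => (termCurve_of_functional (hEd i hi) (hEb i hi) hR0 (h𝓗d x hx) (h𝓗b x hx)).1)
    (fun x hx i hi => (termCurve_of_functional (hEd i hi) (hEb i hi) hR0 (h𝓗d x hx) (h𝓗b x hx)).2)
    (fun x _ => hsum) hreal

/-- … together with END-II's `hB𝓔 : 0 ≤ B_𝓔` for `B_𝓔 = 3H̄/(R − 1)` (`0 ≤ H̄` from `0 ≤ e_i`). [folklore] -/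
theorem hB𝓔_of_functionals {ι : Type*} (I : Finset ι) {e : ι → ℝ} {Hbar R : ℝ} (hR : 1 < R)
    (he : ∀ i ∈ I, 0 ≤ e i) (hsum : ∑ i ∈ I, 2 * e i ≤ Hbar) : 0 ≤ 3 * Hbar / (R - 1) :=
  rayConst_nonneg hR ((Finset.sum_nonneg fun i hi => by linarith [he i hi]).trans hsum)

end EndTwo

/-! ## §3 Row S22's Landau ray inhabits the curve hypotheses -/

section LandauRay

variable {𝒳 : Type*} [NormedAddCommGroup 𝒳] [NormedSpace ℂ 𝒳]

/-- **THE LANDAU RAY AS A CURVE INTO THE TERMS' DOMAIN.**  With the data of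
`ShellMeasureLandauFixedPoint.landauCorrection_along` ∕ `bondFn_landau_along` — `Y` holomorphic on the disc with
`‖Y_σ‖ < ε`, `D` holomorphic with `‖D_σ‖ ≤ 4C₂ε²`, `‖H X‖ ≤ B₀‖X‖` — and the located coupling
`ε + B₀·4C₂ε² ≤ r_E`: the Landau-gauge curve `σ ↦ Y_σ − H D_σ` is holomorphic on the disc and maps it into
`ball 0 r_E` (the hypotheses `h𝓗d`/`h𝓗b` of §2 at one window point). [folklore] -/
theorem landauRay_curve (H : 𝒳 →L[ℂ] 𝒴) {B₀ : ℝ} (hB₀ : 0 ≤ B₀) (hH : ∀ X, ‖H X‖ ≤ B₀ * ‖X‖)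
    {C₂ ε Rad rE : ℝ} {Y : ℂ → 𝒴} {Dc : ℂ → 𝒳} (hYd : DifferentiableOn ℂ Y (ball 0 Rad))
    (hY : ∀ σ ∈ ball (0 : ℂ) Rad, ‖Y σ‖ < ε) (hDd : DifferentiableOn ℂ Dc (ball 0 Rad))
    (hDb : ∀ σ ∈ ball (0 : ℂ) Rad, ‖Dc σ‖ ≤ 4 * C₂ * ε ^ 2) (hcoupE : ε + B₀ * (4 * C₂ * ε ^ 2) ≤ rE) :
    DifferentiableOn ℂ (fun σ => Y σ - H (Dc σ)) (ball 0 Rad) ∧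
      MapsTo (fun σ => Y σ - H (Dc σ)) (ball (0 : ℂ) Rad) (ball (0 : 𝒴) rE) := by
  refine ⟨hYd.sub (H.differentiable.comp_differentiableOn hDd), fun σ hσ => ?_⟩
  rw [mem_ball_zero_iff]
  calc ‖Y σ - H (Dc σ)‖ ≤ ‖Y σ‖ + ‖H (Dc σ)‖ := norm_sub_le _ _
    _ < ε + B₀ * (4 * C₂ * ε ^ 2) :=
        add_lt_add_of_lt_of_le (hY σ hσ) ((hH _).trans (mul_le_mul_of_nonneg_left (hDb σ hσ) hB₀))
    _ ≤ rE := hcoupE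

/-- **ONE WINDOW POINT, ONE CALL**: per-term functional pairs + the S22 Landau ray over that point (+ coupling +
dictionary) ⟹ S16's per-term data `hg`/`hosc` for `g i := 𝓔_i ∘ (Y − H D)` with `H i = 2e_i` — ready for
`rayBound_of_analytic_terms` / `ShellMeasureRayWiringEnd.slotAC_realized_su2_of_levelData_cube_rayTerms`.
[folklore] -/
theorem rayTerms_of_functionals_landau (H : 𝒳 →L[ℂ] 𝒴) {B₀ : ℝ} (hB₀ : 0 ≤ B₀) (hH : ∀ X, ‖H X‖ ≤ B₀ * ‖X‖)
    {C₂ ε Rad rE : ℝ} (hRad : 0 < Rad) {Y : ℂ → 𝒴} {Dc : ℂ → 𝒳} (hYd : DifferentiableOn ℂ Y (ball 0 Rad))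
    (hY : ∀ σ ∈ ball (0 : ℂ) Rad, ‖Y σ‖ < ε) (hDd : DifferentiableOn ℂ Dc (ball 0 Rad))
    (hDb : ∀ σ ∈ ball (0 : ℂ) Rad, ‖Dc σ‖ ≤ 4 * C₂ * ε ^ 2) (hcoupE : ε + B₀ * (4 * C₂ * ε ^ 2) ≤ rE)
    {ι : Type*} (I : Finset ι) {Ef : ι → 𝒴 → ℂ} {e : ι → ℝ}
    (hEd : ∀ i ∈ I, DifferentiableOn ℂ (Ef i) (ball 0 rE)) (hEb : ∀ i ∈ I, ∀ Z ∈ ball (0 : 𝒴) rE, ‖Ef i Z‖ ≤ e i) :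
    (∀ i ∈ I, DifferentiableOn ℂ (fun w => Ef i (Y w - H (Dc w))) (ball 0 Rad)) ∧
      ∀ i ∈ I, ∀ w ∈ ball (0 : ℂ) Rad, ‖Ef i (Y w - H (Dc w)) - Ef i (Y 0 - H (Dc 0))‖ ≤ 2 * e i := by
  obtain ⟨hd, hm⟩ := landauRay_curve H hB₀ hH hYd hY hDd hDb hcoupE
  exact ⟨fun i hi => (termCurve_of_functional (hEd i hi) (hEb i hi) hRad hd hm).1,
    fun i hi => (termCurve_of_functional (hEd i hi) (hEb i hi) hRad hd hm).2⟩

end LandauRay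

end Summit.QuantumFields.BalabanUV.T4Continuum.ShellMeasureRayTermsAlong
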